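import Literature.MathematicalPhysics.PowerSystems.AcyclicSynchronizationCondition
import HarnessLib

/-!
# Synchronous states of a lossless network with ONE cycle: tree flows loaded by a single loop flow
# (Dörfler–Chertkov–Bullo 2013 SI Thm 1 (1) / Delabays–Coletta–Jacquod 2016 Thm 3.6 on a unicyclic
# graph), and a FINITE census of the loop flow ⇒ a finite census of the pinned synchronous states

Topic `Literature/MathematicalPhysics/PowerSystems`, namespace
`Literature.MathematicalPhysics.PowerSystems.ClassicalModel.UnicyclicNetwork` (companion of
`ClassicalModel.RadialNetwork` in `AcyclicSynchronizationCondition.lean`, whose rooted-tree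
vocabulary — `root`, `parent`, `depth`, couplings supported on tree edges, tree flows `u` with the
node-wise conservation law, `flow_eq_treeFlow`, `treeFlow_unique` — is used UNCHANGED). Everything is
PROVED from Mathlib and that file; the two `def`s (`chordSign`, `treeCoupling`) are plumbing with
bodies; no named fact, standard axioms.

WHY (LADDER-GRIDFUSION line «G2.b-SP-EQ-ISOLATION-THM»). `FiniteEquilibriumSetIsolation.lean`
reduces the isolation hypothesis `hiso` of every global convergence theorem of the three swing-model
tiers to a FINITE CENSUS of the pinned synchronous states in one period box; for a meshed network on
`n` nodes that census lives in dimension `n − 1`, out of reach of bisection for `n ≳ 5` (WSCC9: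
structure-preserving, 12 nodes). For a network with ONE independent cycle (a spanning tree plus one
chord — the WSCC 9-bus ring 4–5–7–8–9–6 with its pendant generator nodes is of this kind) the census
is ONE-dimensional: the flows of any synchronous state are the unique tree flows of the injections
loaded by a single LOOP FLOW `f` on the cycle (§2), so a state is pinned down by `f` (equivalently by
the chord sine `sin(θ_u − θ_v)`) and the branch (cosine sign) of each tree edge; hence finitely many
admissible loop flows ⇒ finitely many pinned states (§3) — and the admissible loop flows of each
branch pattern are the zeros of ONE one-variable elementary function, countable by the kernel
(`Literature.Analysis.ValidatedNumerics.zeroCount_sound`).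

SOURCES (read on the page).
* F. Dörfler, M. Chertkov, F. Bullo, PNAS 110 (2013), SI §3.1 [DorflerChertkovBullo2013]
  (arXiv:1208.0045 chunk p0017), **SI Theorem 1 (1)**: «Every solution of the auxiliary fixed-point
  equations is of the form `ψ = BᵀL†ω + ψ_hom`, where the homogeneous solution `ψ_hom` satisfies
  `diag(a_ij) ψ_hom ∈ Ker(B)`» — for a unicyclic graph `Ker(B)` is the line spanned by the signed
  cycle vector: ONE loop-flow parameter.
* R. Delabays, T. Coletta, P. Jacquod, «Multistability of phase-locking and topological winding
  numbers in locally coupled Kuramoto models on single-loop networks», J. Math. Phys. 57 (2016) 032701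
  [DelabaysColettaJacquod2016] (arXiv:1512.04266, `lit read` chunks p0007–p0009): **Theorem 3.6**
  «two distributions of flows on `G` … satisfying Kirchhoff's currents law … differ by a combination of
  loop flows on the different cycles of `G`» (proof: spanning tree `T`, edges of `G ∖ T`, `ker(A)` = the
  cycle space); §3 after it: «any flow `{P_{i,i+1}}` on a cycle can be written as the sum of a reference
  solution … and a loop flow of intensity `Kε` … `P_{i,i+1} = P*_{i,i+1} + Kε` … We call `ε ∈ [−1, 1]`
  the loop flow parameter»; Def. 3.7 (angle differences «taken modulo `2π` in the interval `(−π, π]`»,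
  winding number); p0009: «The number of solutions is thus related to the number of acceptable,
  discrete loop flows».

## Rendering (tree vocabulary of `AcyclicSynchronizationCondition.lean` plus one chord)
A UNICYCLIC network on `Fin n`: a rooted spanning tree (`root`, `parent`, `depth`,
`depth i = depth (parent i) + 1`), a CHORD `{u, v}` (`u ≠ v`, not a tree edge), a symmetric coupling
`C` supported on the tree edges and the chord (`hsupp`), live tree edges `C_{i, parent i} > 0` where
needed. `chordSign u v i = [i = u] − [i = v]` is the chord's signed incidence; `treeCoupling C u v` is
`C` with the chord removed. Tree flows are unbundled as before: `w` with
`Q_i = [i ≠ root]·w_i − Σ_{children j} w_j` for the relevant injections `Q` (rational, checkable per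
instance: `w⁰` for `P`, `χ` for the chord's unit injection `e_u − e_v`).

## What is proved
§1 `treeCoupling_symm/_support/_parent`, **`flow_eq_tree_add_chord`**:
`F_i(θ) = Σ_j C^tree_ij sin(θ_i − θ_j) + χ_i · C_uv sin(θ_u − θ_v)`.

§2 **`treeSine_eq_of_equilibrium`** (SI Thm 1 (1) / Thm 3.6, unicyclic case, «⇒»): for an equilibrium
`F(θ) = P`, every tree edge carries the tree flow of the LOADED injections `P − f·(e_u − e_v)`,
`f = C_uv sin(θ_u − θ_v)`: `C_{i,parent i} sin(θ_i − θ_{parent i}) = w_i`;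
**`equilibrium_of_treeSine_eq`** («⇐»); **`loaded_treeFlow`** (the loaded tree flows are
`w⁰ − f·χ` — the printed `P_{i,i+1} = P*_{i,i+1} + Kε`).

§3 **`finite_pinned_equilibria_of_finite_loopSines`**: if the chord sine `sin(θ_u − θ_v)` of every
pinned (`θ_root = 0`) equilibrium of the period box `[−π, π)ⁿ` lies in a finite set `S`, the pinned
equilibria of the period box are FINITELY MANY (injection `θ ↦ (sin(θ_u − θ_v), signs of the edge
cosines)`: equal data ⇒ equal edge sines (§2, `a_i > 0`) and cosines ⇒ edge angles equal modulo `2π` ⇒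
node angles equal modulo `2π` down the tree ⇒ equal in the box).

§4 **`angle_sub_root_eq_sum`**, **`angle_sub_eq_sum_sub_sum`**: `θ_i − θ_root = Σ_{k<depth i}
φ_{parent^k i}` (edge angles along the parent chain), hence `θ_u − θ_v` in edge angles — the form in
which the chord equation is written for the one-variable census. §5 **`flow_sub_indicator_two_pi`**,
**`finite_pinned_Icc_of_finite_pinned_Ico`**: finiteness on the half-open period box `[−π, π)ⁿ`
transfers to the closed box `[−π, π]ⁿ` (the census form of `FiniteEquilibriumSetIsolation`'s tier
theorems), by whole-turn shifts of the coordinates equal to `π`.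

## Use (model seats; e.g. WSCC9SP for ★ #104 / «#104′-INST», K₃ = Chiang's system as a check)
(i) present the network as tree + chord with rational `w⁰`, `χ` (conservation identities by
`norm_num`); (ii) PARAMETER = the ANGLE `t` of one cycle tree edge `k` (so `f(t) = (w⁰_k − a_k sin t)/χ_k`;
parametrising by the chord sine instead puts square-root singularities at the transfer limits — see the
worked K₃ instance `ChiangThreeMachineLoopFlowCensus.lean`); for each branch pattern `σ` of the OTHER
tree edges on the cycle path write the chord equation `C_uv sin(θ_u − θ_v) = f(t)` in edge angles
(§4, angle addition along the path; `sin φ_i = (w⁰_i − f(t) χ_i)/a_i`, `cos φ_i = (−1)^{σ_i} √(1 − sin² φ_i)`;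
the chord's cosine never enters) as a one-variable code list `g_σ` (`FExpr 1` with `sqrt`) and prove
that every pinned equilibrium's `t` is a zero of some `g_σ`; (iii) count the zeros of each `g_σ` on
`[−63/20, 63/20] ⊇ [−π, π)` by `zeroCount cfg … = some m_σ` (`decide +kernel`, with a seed
configuration carrying square-root refinement steps, e.g. `⟨40, 30, 12, 3, 20⟩`); (iv) `S` := the
chord sines `f(t)/C_uv` over the union of those zero sets (finite) ⇒ §3 (⇒ §5 for the closed box) ⇒
`FiniteEquilibriumSetIsolation.exists_levelIsolation_of_finite_pinned` ⇒ `hiso` ⇒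
`…tendsto_syncFrame_of_cohesive`. Caveat for (iii): `√` code lists are certified only on boxes where
the radicand is enclosed positive — split off `t`-ranges on which another path edge saturates and
parametrise by that edge there. TODO(general form): several independent cycles (loop flows add on shared
edges, [DelabaysColettaJacquod2016, §6]); constant-angle buses (`LosslessSystem n m`, no pinning).

## Three columns
CERTIFIED: the theorems (kernel, no numerics). VALIDATED: nothing numerical is claimed here; winding
numbers / counts of stable states in print [DelabaysColettaJacquod2016, §4–§5] are context. MODELLED:
lossless couplings `a_ij sin(θ_i − θ_j)` with constant voltage magnitudes on a unicyclic graph — the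
common equilibrium equations of the classical, structure-preserving and droop/Kuramoto tiers.

## Mathlib / tree search
`lean search 'loop flow' / 'cycle space' / 'winding'`: nothing on flow networks in the tree beyond
`ClassicalModel.RadialNetwork` (trees); Mathlib's `SimpleGraph` cycle space is not used (the unbundled
rooted-tree presentation of the radial file is kept so that instances stay `decide`/`norm_num`-checkable).

## References
* [DorflerChertkovBullo2013] F. Dörfler, M. Chertkov, F. Bullo, PNAS 110 (2013) 2005–2010, SI §3.1
  Thm 1 (1).
* [DelabaysColettaJacquod2016] R. Delabays, T. Coletta, P. Jacquod, J. Math. Phys. 57 (2016) 032701,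
  §3 Thm 3.6, loop flow parameter, Def. 3.7.

AI-produced formalisation (LADDER-GRIDFUSION seat gridfusion-lit-1 g10, 2026-08-27).
-/

set_option autoImplicit false

open Real Finset Set

namespace Literature.MathematicalPhysics.PowerSystems.ClassicalModel.UnicyclicNetwork

variable {n : ℕ}

/-! ### §1. Tree + one chord: the nodal flow splits into the tree part and the chord (loop) part -/

/-- The signed incidence of the chord `{u, v}` at node `i`: `+1` at `u`, `−1` at `v`, `0` elsewhere
(the column of the incidence matrix belonging to the non-tree edge).
[cite: DelabaysColettaJacquod2016, §3 (loop flow of intensity `Kε` around the cycle)] -/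
noncomputable def chordSign (u v i : Fin n) : ℝ := (if i = u then 1 else 0) - (if i = v then 1 else 0)

/-- The TREE part of the coupling: the chord entries are removed.
[cite: DelabaysColettaJacquod2016, §3 proof of Thm 3.6 (spanning tree `T` of `G`, edges of `G ∖ T`)] -/
noncomputable def treeCoupling (C : Fin n → Fin n → ℝ) (u v : Fin n) : Fin n → Fin n → ℝ :=
  fun i j => if (i = u ∧ j = v) ∨ (i = v ∧ j = u) then 0 else C i j

/-- The tree part is symmetric if `C` is. [cite: DelabaysColettaJacquod2016, §3 proof of Thm 3.6] -/
theorem treeCoupling_symm {C : Fin n → Fin n → ℝ} (hC : ∀ i j, C i j = C j i) (u v i j : Fin n) :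
    treeCoupling C u v i j = treeCoupling C u v j i := by
  unfold treeCoupling
  by_cases h1 : (i = u ∧ j = v) ∨ (i = v ∧ j = u)
  · have h2 : (j = u ∧ i = v) ∨ (j = v ∧ i = u) := by tauto
    rw [if_pos h1, if_pos h2]
  · have h2 : ¬((j = u ∧ i = v) ∨ (j = v ∧ i = u)) := by tauto
    rw [if_neg h1, if_neg h2, hC]

/-- The tree part is supported on the tree edges when `C` is supported on tree edges ∪ the chord.
[cite: DelabaysColettaJacquod2016, §3 proof of Thm 3.6] -/
theorem treeCoupling_support {root : Fin n} {parent : Fin n → Fin n} {C : Fin n → Fin n → ℝ}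
    {u v : Fin n}
    (hsupp : ∀ i j, i ≠ j → C i j ≠ 0 →
      ((i ≠ root ∧ j = parent i) ∨ (j ≠ root ∧ i = parent j)) ∨ ((i = u ∧ j = v) ∨ (i = v ∧ j = u))) :
    ∀ i j, i ≠ j → treeCoupling C u v i j ≠ 0 →
      (i ≠ root ∧ j = parent i) ∨ (j ≠ root ∧ i = parent j) := by
  intro i j hij h
  unfold treeCoupling at h
  by_cases hc : (i = u ∧ j = v) ∨ (i = v ∧ j = u)
  · rw [if_pos hc] at h; exact absurd rfl h
  · rw [if_neg hc] at h
    rcases hsupp i j hij h with ht | hc'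
    · exact ht
    · exact absurd hc' hc

/-- On a tree edge the tree part equals `C` (the chord is not a tree edge).
[cite: DelabaysColettaJacquod2016, §3 proof of Thm 3.6] -/
theorem treeCoupling_parent {root : Fin n} {parent : Fin n → Fin n} (C : Fin n → Fin n → ℝ)
    {u v : Fin n} (hchord : ¬((u ≠ root ∧ v = parent u) ∨ (v ≠ root ∧ u = parent v)))
    {i : Fin n} (hi : i ≠ root) : treeCoupling C u v i (parent i) = C i (parent i) := by
  unfold treeCoupling
  rw [if_neg]
  rintro (⟨rfl, hv⟩ | ⟨rfl, hu⟩)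
  · exact hchord (Or.inl ⟨hi, hv.symm⟩)
  · exact hchord (Or.inr ⟨hi, hu.symm⟩)

/-- **Flow decomposition**: the nodal flow is the tree part plus the chord's contribution
`χᵢ · b sin(θ_u − θ_v)` (`b = C u v`, `χ` the chord's signed incidence).
[cite: DelabaysColettaJacquod2016, §3 Thm 3.6 and the display `P_{i,i+1} = P*_{i,i+1} + Kε`] -/
theorem flow_eq_tree_add_chord (C : Fin n → Fin n → ℝ) (hC : ∀ i j, C i j = C j i) {u v : Fin n}
    (huv : u ≠ v) (θ : Fin n → ℝ) (i : Fin n) :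
    ∑ j, C i j * Real.sin (θ i - θ j)
      = ∑ j, treeCoupling C u v i j * Real.sin (θ i - θ j)
        + chordSign u v i * (C u v * Real.sin (θ u - θ v)) := by
  classical
  have hsplit : ∀ j, C i j * Real.sin (θ i - θ j)
      = treeCoupling C u v i j * Real.sin (θ i - θ j)
        + (if (i = u ∧ j = v) ∨ (i = v ∧ j = u) then C i j else 0) * Real.sin (θ i - θ j) := by
    intro j
    unfold treeCoupling
    split_ifs <;> ring
  rw [Finset.sum_congr rfl fun j _ => hsplit j, Finset.sum_add_distrib]
  congr 1
  unfold chordSign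
  by_cases hiu : i = u
  · subst hiu
    rw [if_pos rfl, if_neg huv, Finset.sum_eq_single v]
    · rw [if_pos (Or.inl ⟨rfl, rfl⟩)]; ring
    · intro j _ hjv
      rw [if_neg]; · ring
      rintro (⟨-, h⟩ | ⟨h, -⟩)
      · exact hjv h
      · exact huv h
    · intro h; exact absurd (Finset.mem_univ v) h
  · by_cases hiv : i = v
    · subst hiv
      rw [if_neg hiu, if_pos rfl, Finset.sum_eq_single u]
      · rw [if_pos (Or.inr ⟨rfl, rfl⟩), hC i u,
          show θ i - θ u = -(θ u - θ i) by ring, Real.sin_neg]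
        ring
      · intro j _ hju
        rw [if_neg]; · ring
        rintro (⟨h, -⟩ | ⟨-, h⟩)
        · exact hiu h
        · exact hju h
      · intro h; exact absurd (Finset.mem_univ u) h
    · rw [if_neg hiu, if_neg hiv]
      have : ∀ j, (if (i = u ∧ j = v) ∨ (i = v ∧ j = u) then C i j else 0) * Real.sin (θ i - θ j)
          = 0 := by
        intro j
        rw [if_neg]; · ring
        rintro (⟨h, -⟩ | ⟨h, -⟩)
        · exact hiu h
        · exact hiv h
      rw [Finset.sum_congr rfl fun j _ => this j, Finset.sum_const_zero]
      ring

/-! ### §2. Equilibria are tree flows loaded by the loop flow (DCB 2013 SI Thm 1 (1) /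
DCJ 2016 Thm 3.6 on a unicyclic graph) -/

/-- **Loop-flow form of the equilibrium equations.** On a tree-plus-one-chord network (rooted tree;
`C` symmetric, supported on the tree edges and the chord `{u, v}`, `u ≠ v`, the chord not a tree
edge): if `θ` is a synchronous equilibrium `F(θ) = P` and `w` are THE tree flows of the injections
loaded by the loop flow `f = C_{uv} sin(θ_u − θ_v)` (conservation
`P_i − χ_i f = [i ≠ root]·w_i − Σ_{children j} w_j`), then every tree edge carries exactly `w`:
`C_{i,parent i} sin(θ_i − θ_{parent i}) = w_i`.
[cite: DorflerChertkovBullo2013, SI §3.1 Thm 1 (1) (ψ = BᵀL†ω + ψ_hom, diag(a)ψ_hom ∈ Ker B); DelabaysColettaJacquod2016, §3 Thm 3.6 and the loop flow parameter `ε`] -/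
theorem treeSine_eq_of_equilibrium {root : Fin n} {parent : Fin n → Fin n} {depth : Fin n → ℕ}
    (hdepth : ∀ i, i ≠ root → depth i = depth (parent i) + 1)
    (C : Fin n → Fin n → ℝ) (hC : ∀ i j, C i j = C j i) {u v : Fin n} (huv : u ≠ v)
    (hchord : ¬((u ≠ root ∧ v = parent u) ∨ (v ≠ root ∧ u = parent v)))
    (hsupp : ∀ i j, i ≠ j → C i j ≠ 0 →
      ((i ≠ root ∧ j = parent i) ∨ (j ≠ root ∧ i = parent j)) ∨ ((i = u ∧ j = v) ∨ (i = v ∧ j = u)))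
    (P w θ : Fin n → ℝ) (heq : ∀ i, ∑ j, C i j * Real.sin (θ i - θ j) = P i)
    (hcons : ∀ i, P i - chordSign u v i * (C u v * Real.sin (θ u - θ v))
      = (if i ≠ root then w i else 0)
        - ∑ j ∈ Finset.univ.filter (fun j => j ≠ root ∧ parent j = i), w j) :
    ∀ i, i ≠ root → C i (parent i) * Real.sin (θ i - θ (parent i)) = w i := by
  classical
  set Ct := treeCoupling C u v with hCt
  have hCt_symm : ∀ i j, Ct i j = Ct j i := treeCoupling_symm hC u v
  have hCt_tree := treeCoupling_support (root := root) (parent := parent) hsupp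
  -- the difference of the two flow systems is a homogeneous tree flow
  set d : Fin n → ℝ := fun i => C i (parent i) * Real.sin (θ i - θ (parent i)) - w i with hd
  have hhom : ∀ i, (if i ≠ root then d i else 0)
      = ∑ j ∈ Finset.univ.filter (fun j => j ≠ root ∧ parent j = i), d j := by
    intro i
    have h1 := heq i
    rw [flow_eq_tree_add_chord C hC huv θ i,
      RadialNetwork.flow_eq_treeFlow hdepth Ct hCt_symm hCt_tree θ i] at h1
    have h2 := hcons i
    -- rewrite the tree couplings on tree edges
    have hpar : ∀ j, j ≠ root → Ct j (parent j) = C j (parent j) :=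
      fun j hj => treeCoupling_parent C hchord hj
    have hsum : ∑ j ∈ Finset.univ.filter (fun j => j ≠ root ∧ parent j = i),
        Ct j (parent j) * Real.sin (θ j - θ (parent j))
        = ∑ j ∈ Finset.univ.filter (fun j => j ≠ root ∧ parent j = i),
            C j (parent j) * Real.sin (θ j - θ (parent j)) := by
      refine Finset.sum_congr rfl fun j hj => ?_
      simp only [Finset.mem_filter, Finset.mem_univ, true_and] at hj
      rw [hpar j hj.1]
    rw [hsum] at h1
    simp only [hd]
    rw [Finset.sum_sub_distrib]
    by_cases hi : i ≠ root
    · rw [if_pos hi] at h1 h2 ⊢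
      rw [hpar i hi] at h1
      linarith
    · rw [if_neg hi] at h1 h2 ⊢
      linarith
  have hzero := RadialNetwork.treeFlow_unique hdepth d hhom
  intro i hi
  have := hzero i hi
  simp only [hd] at this
  linarith

/-- **Converse**: tree flows `w` loaded by the loop flow that ARE the edge sines give an equilibrium.
[cite: DelabaysColettaJacquod2016, §3 Thm 3.6; DorflerChertkovBullo2013, SI §3.1 Thm 1 (1)] -/
theorem equilibrium_of_treeSine_eq {root : Fin n} {parent : Fin n → Fin n} {depth : Fin n → ℕ}
    (hdepth : ∀ i, i ≠ root → depth i = depth (parent i) + 1)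
    (C : Fin n → Fin n → ℝ) (hC : ∀ i j, C i j = C j i) {u v : Fin n} (huv : u ≠ v)
    (hchord : ¬((u ≠ root ∧ v = parent u) ∨ (v ≠ root ∧ u = parent v)))
    (hsupp : ∀ i j, i ≠ j → C i j ≠ 0 →
      ((i ≠ root ∧ j = parent i) ∨ (j ≠ root ∧ i = parent j)) ∨ ((i = u ∧ j = v) ∨ (i = v ∧ j = u)))
    (P w θ : Fin n → ℝ)
    (hsin : ∀ i, i ≠ root → C i (parent i) * Real.sin (θ i - θ (parent i)) = w i)
    (hcons : ∀ i, P i - chordSign u v i * (C u v * Real.sin (θ u - θ v))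
      = (if i ≠ root then w i else 0)
        - ∑ j ∈ Finset.univ.filter (fun j => j ≠ root ∧ parent j = i), w j) :
    ∀ i, ∑ j, C i j * Real.sin (θ i - θ j) = P i := by
  classical
  set Ct := treeCoupling C u v with hCt
  have hCt_symm : ∀ i j, Ct i j = Ct j i := treeCoupling_symm hC u v
  have hCt_tree := treeCoupling_support (root := root) (parent := parent) hsupp
  have hpar : ∀ j, j ≠ root → Ct j (parent j) = C j (parent j) :=
    fun j hj => treeCoupling_parent C hchord hj
  intro i
  rw [flow_eq_tree_add_chord C hC huv θ i, RadialNetwork.flow_eq_treeFlow hdepth Ct hCt_symm hCt_tree θ i]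
  have h2 := hcons i
  have hsum : ∑ j ∈ Finset.univ.filter (fun j => j ≠ root ∧ parent j = i),
      Ct j (parent j) * Real.sin (θ j - θ (parent j))
      = ∑ j ∈ Finset.univ.filter (fun j => j ≠ root ∧ parent j = i), w j := by
    refine Finset.sum_congr rfl fun j hj => ?_
    simp only [Finset.mem_filter, Finset.mem_univ, true_and] at hj
    rw [hpar j hj.1, hsin j hj.1]
  rw [hsum]
  by_cases hi : i ≠ root
  · rw [if_pos hi, hpar i hi, hsin i hi]
    rw [if_pos hi] at h2
    linarith
  · rw [if_neg hi]
    rw [if_neg hi] at h2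
    linarith

/-- **The loaded tree flows are affine in the loop flow**: if `w⁰` are the tree flows of `P` and
`χ` those of the chord's unit injection `e_u − e_v`, then `w⁰ − f·χ` are the tree flows of
`P − f·(e_u − e_v)` — the printed `P_{i,i+1} = P*_{i,i+1} + Kε` (one loop-flow parameter).
[cite: DelabaysColettaJacquod2016, §3 (reference solution `P*` and loop flow parameter `ε`)] -/
theorem loaded_treeFlow {root : Fin n} {parent : Fin n → Fin n} {u v : Fin n}
    (P w0 χ : Fin n → ℝ)
    (h0 : ∀ i, P i = (if i ≠ root then w0 i else 0)
      - ∑ j ∈ Finset.univ.filter (fun j => j ≠ root ∧ parent j = i), w0 j)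
    (hχ : ∀ i, chordSign u v i = (if i ≠ root then χ i else 0)
      - ∑ j ∈ Finset.univ.filter (fun j => j ≠ root ∧ parent j = i), χ j) (f : ℝ) :
    ∀ i, P i - chordSign u v i * f = (if i ≠ root then w0 i - f * χ i else 0)
      - ∑ j ∈ Finset.univ.filter (fun j => j ≠ root ∧ parent j = i), (w0 j - f * χ j) := by
  classical
  intro i
  rw [h0 i, hχ i, Finset.sum_sub_distrib]
  have : ∑ j ∈ Finset.univ.filter (fun j => j ≠ root ∧ parent j = i), f * χ j
      = f * ∑ j ∈ Finset.univ.filter (fun j => j ≠ root ∧ parent j = i), χ j := by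
    rw [Finset.mul_sum]
  rw [this]
  by_cases hi : i ≠ root
  · simp only [if_pos hi]; ring
  · simp only [if_neg hi]; ring

/-! ### §3. A finite census of loop flows gives a finite census of pinned equilibria -/

/-- Two angles with the same sine and cosines of the same sign differ by a whole turn (private).
[folklore] [cite: DelabaysColettaJacquod2016, §3 Def. 3.7 (angle differences taken modulo 2π)] -/
private theorem exists_int_of_sin_eq_of_cos_sign {x y : ℝ} (hs : Real.sin x = Real.sin y)
    (hc : (0 ≤ Real.cos x ↔ 0 ≤ Real.cos y)) : ∃ k : ℤ, x - y = k * (2 * π) := by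
  have hcos : Real.cos x = Real.cos y := by
    have h2 : (Real.cos x - Real.cos y) * (Real.cos x + Real.cos y) = 0 := by
      have hx := Real.sin_sq_add_cos_sq x
      have hy := Real.sin_sq_add_cos_sq y
      rw [hs] at hx
      nlinarith
    rcases mul_eq_zero.1 h2 with h | h
    · linarith
    · -- opposite cosines with the same sign are both zero
      rcases le_or_gt 0 (Real.cos x) with hx | hx
      · have hy := hc.1 hx; linarith
      · have hy : Real.cos y < 0 := by
          by_contra hy; push Not at hy; exact absurd (hc.2 hy) (not_le.2 hx)
        linarith
  have h1 : Real.cos (x - y) = 1 := by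
    rw [Real.cos_sub, hcos, hs]
    nlinarith [Real.sin_sq_add_cos_sq y]
  obtain ⟨k, hk⟩ := (Real.cos_eq_one_iff (x - y)).1 h1
  exact ⟨k, hk.symm⟩

/-- **A finite census of the loop flow is a finite census of the synchronous states.** On a
tree-plus-one-chord network with live tree edges (`C_{i,parent i} > 0`), let `w⁰` be the tree flows
of `P` and `χ` those of the chord's unit injection. If the chord-angle sine `sin(θ_u − θ_v)` of every
PINNED equilibrium of the period box (`θ_root = 0`, `θ ∈ [−π, π)ⁿ`) lies in a FINITE set `S` (in
practice: the union of the zero sets of the finitely many one-variable loop-flow consistency functions,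
one per branch pattern of the cycle, each counted by a kernel bisection certificate), then the pinned
equilibria of the period box are finitely many — the census hypothesis of
`FiniteEquilibriumSetIsolation.exists_levelIsolation_of_finite_pinned`. Mechanism: a pinned equilibrium
is determined by `sin(θ_u − θ_v)` and the signs of the edge cosines (`sin φ_i = (w⁰_i − fχ_i)/a_i`
is then fixed on every tree edge, hence `φ_i` modulo `2π`, hence `θ` down the tree) — «the number of
solutions is … related to the number of acceptable, discrete loop flows».
[cite: DelabaysColettaJacquod2016, §3 (loop flow parameter `ε`; «The number of solutions is thus related to the number of acceptable, discrete loop flows»); DorflerChertkovBullo2013, SI §3.1 Thm 1 (1)] -/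
theorem finite_pinned_equilibria_of_finite_loopSines {root : Fin n} {parent : Fin n → Fin n}
    {depth : Fin n → ℕ} (hdepth : ∀ i, i ≠ root → depth i = depth (parent i) + 1)
    (C : Fin n → Fin n → ℝ) (hC : ∀ i j, C i j = C j i) {u v : Fin n} (huv : u ≠ v)
    (hchord : ¬((u ≠ root ∧ v = parent u) ∨ (v ≠ root ∧ u = parent v)))
    (hsupp : ∀ i j, i ≠ j → C i j ≠ 0 →
      ((i ≠ root ∧ j = parent i) ∨ (j ≠ root ∧ i = parent j)) ∨ ((i = u ∧ j = v) ∨ (i = v ∧ j = u)))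
    (ha : ∀ i, i ≠ root → 0 < C i (parent i)) (P w0 χ : Fin n → ℝ)
    (h0 : ∀ i, P i = (if i ≠ root then w0 i else 0)
      - ∑ j ∈ Finset.univ.filter (fun j => j ≠ root ∧ parent j = i), w0 j)
    (hχ : ∀ i, chordSign u v i = (if i ≠ root then χ i else 0)
      - ∑ j ∈ Finset.univ.filter (fun j => j ≠ root ∧ parent j = i), χ j)
    (S : Finset ℝ)
    (hS : ∀ θ : Fin n → ℝ, θ root = 0 → (∀ i, θ i ∈ Ico (-π) π) →
      (∀ i, ∑ j, C i j * Real.sin (θ i - θ j) = P i) → Real.sin (θ u - θ v) ∈ S) :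
    {θ : Fin n → ℝ | θ root = 0 ∧ (∀ i, θ i ∈ Ico (-π) π) ∧
      ∀ i, ∑ j, C i j * Real.sin (θ i - θ j) = P i}.Finite := by
  classical
  set E : Set (Fin n → ℝ) := {θ | θ root = 0 ∧ (∀ i, θ i ∈ Ico (-π) π) ∧
    ∀ i, ∑ j, C i j * Real.sin (θ i - θ j) = P i} with hE
  set key : (Fin n → ℝ) → ℝ × (Fin n → Bool) := fun θ =>
    (Real.sin (θ u - θ v), fun i => decide (0 ≤ Real.cos (θ i - θ (parent i)))) with hkey
  have himg : key '' E ⊆ (↑S : Set ℝ) ×ˢ (univ : Set (Fin n → Bool)) := by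
    rintro _ ⟨θ, ⟨hr, hb, heq⟩, rfl⟩
    exact ⟨hS θ hr hb heq, mem_univ _⟩
  have hfin : (key '' E).Finite := (S.finite_toSet.prod finite_univ).subset himg
  refine Set.Finite.of_finite_image hfin ?_
  rintro θ ⟨hr, hbox, heq⟩ θ' ⟨hr', hbox', heq'⟩ hk
  have hs : Real.sin (θ u - θ v) = Real.sin (θ' u - θ' v) := congrArg Prod.fst hk
  have hsign : ∀ i, (0 ≤ Real.cos (θ i - θ (parent i)) ↔ 0 ≤ Real.cos (θ' i - θ' (parent i))) := by
    intro i
    have h := congr_fun (congrArg Prod.snd hk) i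
    simp only [hkey] at h
    simpa only [decide_eq_decide] using h
  -- both carry the same loaded tree flows on their edges
  set f : ℝ := C u v * Real.sin (θ u - θ v) with hf
  have hload := loaded_treeFlow (root := root) (parent := parent) P w0 χ h0 hχ f
  have hw : ∀ i, i ≠ root → C i (parent i) * Real.sin (θ i - θ (parent i)) = w0 i - f * χ i :=
    treeSine_eq_of_equilibrium hdepth C hC huv hchord hsupp P (fun i => w0 i - f * χ i) θ heq hload
  have hw' : ∀ i, i ≠ root → C i (parent i) * Real.sin (θ' i - θ' (parent i)) = w0 i - f * χ i := by
    refine treeSine_eq_of_equilibrium hdepth C hC huv hchord hsupp P (fun i => w0 i - f * χ i) θ'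
      heq' fun i => ?_
    rw [← hs]
    exact hload i
  -- edge angles agree modulo 2π
  have hedge : ∀ i, i ≠ root →
      ∃ k : ℤ, (θ i - θ (parent i)) - (θ' i - θ' (parent i)) = k * (2 * π) := by
    intro i hi
    refine exists_int_of_sin_eq_of_cos_sign ?_ (hsign i)
    have h1 := (hw i hi).trans (hw' i hi).symm
    exact mul_left_cancel₀ (ha i hi).ne' h1
  -- node angles agree modulo 2π, down the tree
  have hnode : ∀ m : ℕ, ∀ i, depth i = m → ∃ k : ℤ, θ i - θ' i = k * (2 * π) := by
    intro m
    induction m using Nat.strong_induction_on with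
    | _ m ih =>
      intro i hm
      by_cases hi : i = root
      · subst hi
        exact ⟨0, by rw [hr, hr']; simp⟩
      · have hdp : depth (parent i) < m := by
          have := hdepth i hi; omega
        obtain ⟨kp, hkp⟩ := ih _ hdp (parent i) rfl
        obtain ⟨ke, hke⟩ := hedge i hi
        exact ⟨kp + ke, by push_cast; linarith⟩
  -- in the period box the turn count is zero
  funext i
  obtain ⟨k, hk⟩ := hnode (depth i) i rfl
  obtain ⟨a1, a2⟩ := hbox i
  obtain ⟨b1, b2⟩ := hbox' i
  have hk0 : k = 0 := by
    have hlt : |(k : ℝ)| < 1 := by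
      rw [abs_lt]
      constructor <;> nlinarith [Real.pi_pos]
    have : |k| < 1 := by exact_mod_cast hlt
    rw [abs_lt] at this
    omega
  rw [hk0] at hk
  simp only [Int.cast_zero, zero_mul] at hk
  linarith

/-! ## §4. Unrolling node angles along the tree (writing the chord equation in edge angles)

For step (ii) of the «Use» recipe: the chord equation `C_uv sin(θ_u − θ_v) = f` is written in the
EDGE ANGLES `φ_i = θ_i − θ_{parent i}` of the `u → v` tree path via
`θ_i − θ_root = Σ_{k < depth i} φ_{parent^k i}`; with literal `depth`/`parent` the sums unroll by
`Finset.sum_range_succ`. [cite: DelabaysColettaJacquod2016, §3 proof of Thm 3.6 (paths in the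
spanning tree `T`)] -/

/-- **Node angle relative to the root = the sum of the edge angles along the parent chain.**
[cite: DelabaysColettaJacquod2016, §3 proof of Thm 3.6] -/
theorem angle_sub_root_eq_sum {root : Fin n} {parent : Fin n → Fin n} {depth : Fin n → ℕ}
    (hroot : depth root = 0) (hdepth : ∀ i, i ≠ root → depth i = depth (parent i) + 1)
    (θ : Fin n → ℝ) (i : Fin n) :
    θ i - θ root =
      ∑ k ∈ Finset.range (depth i), (θ (parent^[k] i) - θ (parent (parent^[k] i))) := by
  suffices h : ∀ m : ℕ, ∀ i, depth i = m → θ i - θ root =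
      ∑ k ∈ Finset.range m, (θ (parent^[k] i) - θ (parent (parent^[k] i))) from
    h (depth i) i rfl
  intro m
  induction m with
  | zero =>
    intro i hi
    have : i = root := by
      by_contra hne
      have := hdepth i hne
      omega
    subst this
    simp
  | succ m ih =>
    intro i hi
    have hne : i ≠ root := by
      rintro rfl
      omega
    have hdp : depth (parent i) = m := by
      have := hdepth i hne
      omega
    rw [Finset.sum_range_succ', Function.iterate_zero, id]
    simp only [Function.iterate_succ_apply]
    rw [← ih (parent i) hdp]
    ring

/-- **Angle difference of two nodes in edge angles** (in particular across the chord `{u, v}`).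
[cite: DelabaysColettaJacquod2016, §3 proof of Thm 3.6] -/
theorem angle_sub_eq_sum_sub_sum {root : Fin n} {parent : Fin n → Fin n} {depth : Fin n → ℕ}
    (hroot : depth root = 0) (hdepth : ∀ i, i ≠ root → depth i = depth (parent i) + 1)
    (θ : Fin n → ℝ) (u v : Fin n) :
    θ u - θ v =
      ∑ k ∈ Finset.range (depth u), (θ (parent^[k] u) - θ (parent (parent^[k] u)))
        - ∑ k ∈ Finset.range (depth v), (θ (parent^[k] v) - θ (parent (parent^[k] v))) := by
  rw [← angle_sub_root_eq_sum hroot hdepth θ u, ← angle_sub_root_eq_sum hroot hdepth θ v]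
  ring

/-! ## §5. From the half-open to the closed period box

`§3` censuses the half-open box `[−π, π)ⁿ` (one representative per class); the tier theorems of
`FiniteEquilibriumSetIsolation` (`…exists_levelIsolation_of_finite_syncEquilibria`) are stated on the
closed box `[−π, π]ⁿ`. A configuration of the closed box is a whole-turn shift, on the coordinates
equal to `π`, of one of the half-open box, and the equations are invariant, so finiteness transfers.
[folklore] [cite: DelabaysColettaJacquod2016, Def. 3.7 (angle differences modulo `2π` in `(−π, π]`)] -/

/-- Shifting single coordinates by whole turns does not change the flows. [folklore]
[cite: DelabaysColettaJacquod2016, Def. 3.7] -/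
theorem flow_sub_indicator_two_pi (C : Fin n → Fin n → ℝ) (θ : Fin n → ℝ) (s : Finset (Fin n))
    (i : Fin n) :
    ∑ j, C i j * Real.sin ((θ i - (if i ∈ s then 2 * π else 0)) - (θ j - (if j ∈ s then 2 * π else 0)))
      = ∑ j, C i j * Real.sin (θ i - θ j) := by
  refine Finset.sum_congr rfl fun j _ => ?_
  congr 1
  by_cases hi : i ∈ s <;> by_cases hj : j ∈ s <;> simp only [hi, hj, if_true, if_false, sub_zero]
  · congr 1; ring
  · rw [show θ i - 2 * π - θ j = (θ i - θ j) + (-1 : ℤ) * (2 * π) by push_cast; ring,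
      Real.sin_add_int_mul_two_pi]
  · rw [show θ i - (θ j - 2 * π) = (θ i - θ j) + (1 : ℤ) * (2 * π) by push_cast; ring,
      Real.sin_add_int_mul_two_pi]

/-- **Finitely many pinned equilibria in `[−π, π)ⁿ` ⇒ finitely many in `[−π, π]ⁿ`** (the census
form consumed by `FiniteEquilibriumSetIsolation`). [folklore]
[cite: DelabaysColettaJacquod2016, Def. 3.7] -/
theorem finite_pinned_Icc_of_finite_pinned_Ico (C : Fin n → Fin n → ℝ) (P : Fin n → ℝ)
    (root : Fin n)
    (hfin : {θ : Fin n → ℝ | θ root = 0 ∧ (∀ i, θ i ∈ Ico (-π) π) ∧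
      ∀ i, ∑ j, C i j * Real.sin (θ i - θ j) = P i}.Finite) :
    {θ : Fin n → ℝ | θ root = 0 ∧ (∀ i, θ i ∈ Icc (-π) π) ∧
      ∀ i, ∑ j, C i j * Real.sin (θ i - θ j) = P i}.Finite := by
  classical
  set Eo : Set (Fin n → ℝ) := {θ | θ root = 0 ∧ (∀ i, θ i ∈ Ico (-π) π) ∧
    ∀ i, ∑ j, C i j * Real.sin (θ i - θ j) = P i} with hEo
  -- the closed-box solutions are covered by the shifted images of the half-open-box solutions
  have hcover : {θ : Fin n → ℝ | θ root = 0 ∧ (∀ i, θ i ∈ Icc (-π) π) ∧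
      ∀ i, ∑ j, C i j * Real.sin (θ i - θ j) = P i} ⊆
      ⋃ s ∈ (Finset.univ : Finset (Finset (Fin n))),
        (fun θ : Fin n → ℝ => fun i => θ i + (if i ∈ s then 2 * π else 0)) '' Eo := by
    rintro θ ⟨hr, hbox, heq⟩
    set s : Finset (Fin n) := Finset.univ.filter (fun i => θ i = π) with hs
    refine Set.mem_biUnion (Finset.mem_univ s) ⟨fun i => θ i - (if i ∈ s then 2 * π else 0),
      ⟨?_, fun i => ?_, fun i => ?_⟩, ?_⟩
    · have : root ∉ s := by
        rw [hs, Finset.mem_filter]; rintro ⟨-, h⟩; rw [hr] at h; exact Real.pi_pos.ne' h.symm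
      simp only [this, if_false, sub_zero, hr]
    · obtain ⟨h1, h2⟩ := hbox i
      by_cases hi : i ∈ s
      · have hθ : θ i = π := by rw [hs, Finset.mem_filter] at hi; exact hi.2
        simp only [hi, if_true, hθ]
        constructor <;> linarith [Real.pi_pos]
      · have hθ : θ i ≠ π := by
          intro h; exact hi (by rw [hs, Finset.mem_filter]; exact ⟨Finset.mem_univ _, h⟩)
        simp only [hi, if_false, sub_zero]
        exact ⟨h1, lt_of_le_of_ne h2 hθ⟩
    · rw [flow_sub_indicator_two_pi]; exact heq i
    · funext i; simp
  refine Set.Finite.subset (Set.Finite.biUnion (Finset.finite_toSet _) fun s _ => hfin.image _) hcover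

end Literature.MathematicalPhysics.PowerSystems.ClassicalModel.UnicyclicNetwork
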